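import Mathlib
import Literature.NumberTheory.LFunctions.Zhang2022.TypedSection14
import Literature.NumberTheory.Sieve.DivisorBound
import HarnessLib

/-!
# Zhang (2022) §14: the deduction node of Proposition 14.1, kernel-checked (D15 / cone C36)

Topic `Literature/NumberTheory/LFunctions/Zhang2022` (Landau–Siegel audit tree; verdict-neutral).
Y. Zhang, *Discrete mean estimates and the Landau–Siegel zero*, arXiv:2211.02515v1 (2022)
[Zhang2022LandauSiegel] — **an unrefereed manuscript under adjudication**; this file PROVES printed
inferences between the typed claims of §14 (`TypedSection14.lean`, L3-t7), it does not assert the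
claims themselves and says nothing about Theorems 1–2.

* `dedProp141_holds : Typed.Sec14.DedProp141` — DAG node `Z22:Prop14.1.pf` [Z22 p.78, tex L3905–L3917]:
  "Since `χ(−1)τ(χ)² = D`, the proof of Proposition 14.1 is now reduced to showing (14.5) and (14.6)",
  i.e. (14.3) ∧ u010 ∧ (14.5) ∧ (14.6) ⇒ Proposition 14.1 at `β = 0` (`Prop141Zero`). The bookkeeping
  the manuscript leaves implicit and the kernel supplies: the regrouping `Σ_{ψ∈Ψ} = Σ_{p∼P}Σ*_{ψ mod p}`;
  `Σ_{p∼P} O(PT^{−c}) = O(T^{−c}𝔓)` because `P < p` on the window; `|τ(χ)| = √D`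
  (`LargeSieve.norm_gaussSum_sq`) and `χ(−1)τ(χ)² = D` (`gaussSum_mul_gaussSum_inv`, `χ` real); the
  `D = D₁D₂`, `D₁ > 1` terms of u010 number `d(D) ≤ C_δ D^{δ}` (the divisor bound,
  `Sieve.exists_card_divisors_le_mul_rpow`, `δ = c/2`) so that their total is still `P²D^{−c/2}`; and
  `P²D^{−c} = o(𝔓)`, `T^{−c} = o(1)` from (2.9) `𝔓 ≥ P²/(2𝓛⁷⁷)` (`frakP_bounds`).

Helpers: `sum_finsetOf_univ_eq_sum_primeWindow`, `bigP_lt_of_mem_primeWindow`, `norm_tau_eq_sqrt`,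
`chi_neg_one_mul_tau_sq`, `card_divisorsAntidiagonal_eq`, `tendsto_log_pow_mul_rpow_neg`,
`tendsto_bigT_rpow_neg`, `eventually_bigP_sq_le_frakP`. The companion `Section14Eq145Discharge` proves
the deduction node of (14.5) (`dedEq145_holds`).

## References

* Y. Zhang, arXiv:2211.02515v1 (2022), §14 pp. 76–79, Prop. 14.1, (14.3)–(14.8); §2 (2.9) p. 4;
  §5 Lemma 5.3 p. 25. [cite: Zhang2022LandauSiegel, §14 Prop. 14.1 (proof) pp.76–79]
* G. H. Hardy, E. M. Wright, *An Introduction to the Theory of Numbers*, Thm 315 (divisor bound) —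
  through `Literature.NumberTheory.Sieve.DivisorBound`. [cite: HardyWright2008, Theorem 315]
-/

noncomputable section

open Complex Real ComplexConjugate

namespace Literature.NumberTheory.LFunctions.Zhang2022.Typed.Sec14

open Skeleton Filter

section Discharge

variable {D : ℕ} [NeZero D] (χ : DirichletCharacter ℂ D)

omit [NeZero D] in
/-- Regrouping `Σ_{ψ∈Ψ} = Σ_{p∼P} Σ*_{ψ (mod p)}`: the sum over all of `Ψ` is the sum over the window
of the sums over the members with modulus `p`. [cite: Zhang2022LandauSiegel, §14 (14.3) p.76] -/
theorem sum_finsetOf_univ_eq_sum_primeWindow (f : Chr D → ℂ) :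
    ∑ x ∈ finsetOf (Set.univ : Set (Chr D)), f x =
      ∑ p ∈ primeWindow D, ∑ x ∈ finsetOf {x : Chr D | x.p = p}, f x := by
  classical
  have hmaps : ∀ x ∈ finsetOf (Set.univ : Set (Chr D)), x.p ∈ primeWindow D := fun x _ => x.mem
  rw [← Finset.sum_fiberwise_of_maps_to hmaps f]
  refine Finset.sum_congr rfl fun p _ => Finset.sum_congr ?_ fun _ _ => rfl
  ext x
  simp only [finsetOf, Set.toFinite, dif_pos, Finset.mem_filter, Set.Finite.mem_toFinset,
    Set.mem_univ, true_and, Set.mem_setOf_eq]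

omit [NeZero D] in
/-- On the window `p ∼ P` one has `P < p`. [cite: Zhang2022LandauSiegel, §2 p.4] -/
theorem bigP_lt_of_mem_primeWindow {p : ℕ} (hp : p ∈ primeWindow D) : bigP D < p := by
  have h1 : ⌊bigP D⌋₊ < p := (Finset.mem_Ioo.mp (Finset.mem_filter.mp hp).1).1
  calc bigP D < (⌊bigP D⌋₊ : ℝ) + 1 := Nat.lt_floor_add_one _
    _ ≤ p := by exact_mod_cast h1

/-- `|τ(χ)| = √D` for the primitive `χ (mod D)`. [cite: Zhang2022LandauSiegel, §2 (2.4) p.4] -/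
theorem norm_tau_eq_sqrt (hp : χ.IsPrimitive) : ‖GammaFactor.tau χ‖ = Real.sqrt D := by
  have h := Literature.NumberTheory.Sieve.LargeSieve.norm_gaussSum_sq hp
  rw [GammaFactor.tau]
  rw [← Real.sqrt_sq (norm_nonneg _), h]

/-- `χ(−1)τ(χ)² = D` for the real primitive `χ (mod D)` ("Since `χ(−1)τ(χ)² = D`", p. 78).
[cite: Zhang2022LandauSiegel, §14 (14.5) p.78, tex L3905] -/
theorem chi_neg_one_mul_tau_sq (hq : χ.IsQuadratic) (hp : χ.IsPrimitive) :
    χ (-1) * GammaFactor.tau χ ^ 2 = D := by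
  have h := Literature.NumberTheory.LFunctions.gaussSum_mul_gaussSum_inv χ hp
  rw [hq.inv] at h
  have hsq : χ (-1) * χ (-1) = 1 := by
    rw [← map_mul, neg_mul_neg, one_mul, map_one]
  rw [GammaFactor.tau, sq, h, ← mul_assoc, hsq, one_mul]

omit [NeZero D] in
/-- The number of factorisations `D = D₁D₂` is the number of divisors of `D`. [folklore] -/
private theorem card_divisorsAntidiagonal_eq (n : ℕ) :
    (Nat.divisorsAntidiagonal n).card = n.divisors.card := by
  rw [← Nat.map_div_right_divisors, Finset.card_map]

/-! ### Eventual smallness of the error scales -/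

/-- `(log D)^k · D^{−c} → 0`. [folklore] -/
private theorem tendsto_log_pow_mul_rpow_neg (k : ℕ) {c : ℝ} (hc : 0 < c) :
    Tendsto (fun D : ℕ => Real.log D ^ k * (D : ℝ) ^ (-c)) atTop (nhds 0) := by
  have h1 : Tendsto (fun y : ℝ => y ^ (k : ℝ) * Real.exp (-c * y)) atTop (nhds 0) :=
    tendsto_rpow_mul_exp_neg_mul_atTop_nhds_zero k c hc
  have h2 : Tendsto (fun D : ℕ => Real.log (D : ℝ)) atTop atTop :=
    Real.tendsto_log_atTop.comp tendsto_natCast_atTop_atTop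
  refine ((h1.comp h2).congr' ?_)
  filter_upwards [eventually_gt_atTop 0] with D hD
  have hD' : (0 : ℝ) < D := by exact_mod_cast hD
  simp only [Function.comp_apply]
  rw [Real.rpow_natCast, Real.rpow_def_of_pos hD']
  congr 1
  ring_nf

/-- `T^{−c} → 0` (`T = exp{𝓛^{1.1}}`). [cite: Zhang2022LandauSiegel, §6 p.30] -/
theorem tendsto_bigT_rpow_neg {c : ℝ} (hc : 0 < c) :
    Tendsto (fun D : ℕ => bigT D ^ (-c)) atTop (nhds 0) := by
  have h2 : Tendsto (fun D : ℕ => Real.log (D : ℝ)) atTop atTop :=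
    Real.tendsto_log_atTop.comp tendsto_natCast_atTop_atTop
  have h3 : Tendsto (fun D : ℕ => Real.log (D : ℝ) ^ (1.1 : ℝ)) atTop atTop :=
    (tendsto_rpow_atTop (by norm_num)).comp h2
  have h4 : Tendsto (fun D : ℕ => -c * Real.log (D : ℝ) ^ (1.1 : ℝ)) atTop atBot :=
    h3.const_mul_atTop_of_neg (by linarith)
  have h5 := Real.tendsto_exp_atBot.comp h4
  refine h5.congr' (Eventually.of_forall fun D => ?_)
  simp only [Function.comp_apply, bigT, ell]
  rw [← Real.exp_mul, mul_comm]

omit [NeZero D] χ in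
/-- **(2.9) from below**: eventually `P² ≤ 2𝓛⁷⁷𝔓`. [cite: Zhang2022LandauSiegel, §2 (2.9) p.4] -/
theorem eventually_bigP_sq_le_frakP :
    ∃ D₁ : ℕ, ∀ D : ℕ, D₁ ≤ D → bigP D ^ 2 ≤ 2 * ell D ^ 77 * frakP D := by
  obtain ⟨D₀, h⟩ := frakP_bounds
  refine ⟨max D₀ 9, fun D hD => ?_⟩
  have hD₀ : D₀ ≤ D := le_trans (le_max_left _ _) hD
  have h9 : (9 : ℝ) ≤ D := by exact_mod_cast le_trans (le_max_right _ _) hD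
  have hlog : 2 ≤ Real.log D := by
    have h2 : Real.exp 2 ≤ 9 := by
      have h1 := Real.exp_one_lt_d9
      have h2 : Real.exp 2 = Real.exp 1 * Real.exp 1 := by rw [← Real.exp_add]; norm_num
      rw [h2]; nlinarith [Real.exp_pos 1]
    calc (2 : ℝ) = Real.log (Real.exp 2) := (Real.log_exp 2).symm
      _ ≤ Real.log D := Real.log_le_log (Real.exp_pos 2) (h2.trans h9)
  set L := Real.log D with hL
  have hL68 : 6 ≤ L ^ 68 := by
    calc (6 : ℝ) ≤ 2 ^ 68 := by norm_num
      _ ≤ L ^ 68 := pow_le_pow_left₀ (by norm_num) hlog 68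
  have hb := (abs_le.mp (h D hD₀)).1
  have hP : bigP D = Real.exp (L ^ 9) := by rw [bigP, ell]
  have hℓ : ell D = L := rfl
  rw [hP, hℓ]
  set M := Real.exp (L ^ 9) ^ 2 * (L ^ 77)⁻¹ with hM
  have hM0 : 0 ≤ M := by positivity
  have hL0 : 0 < L := by linarith
  have hL77 : 0 < L ^ 77 := by positivity
  -- `𝔓 ≥ (1 − 3𝓛⁻⁶⁸) M ≥ M/2`
  have h68 : 3 * (L ^ 68)⁻¹ ≤ 1 / 2 := by
    rw [inv_eq_one_div, mul_one_div, div_le_div_iff₀ (by positivity) (by norm_num)]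
    linarith
  have hlow : M / 2 ≤ frakP D := by
    have h1 : M - 3 * (L ^ 68)⁻¹ * M ≤ frakP D := by linarith
    have h2 : 3 * (L ^ 68)⁻¹ * M ≤ 1 / 2 * M := mul_le_mul_of_nonneg_right h68 hM0
    linarith
  have hEq : Real.exp (L ^ 9) ^ 2 = L ^ 77 * M := by
    rw [hM, mul_comm, mul_assoc, inv_mul_cancel₀ hL77.ne', mul_one]
  calc Real.exp (L ^ 9) ^ 2 = L ^ 77 * M := hEq
    _ ≤ L ^ 77 * (2 * frakP D) := by gcongr; linarith
    _ = 2 * L ^ 77 * frakP D := by ring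

end Discharge

/-! ### The deduction node of Proposition 14.1 -/

/-- `Z22:Prop14.1.pf` DISCHARGED (the printed inference, not its inputs): **(14.3) ∧ u010 ∧ (14.5) ∧
(14.6) ⇒ Proposition 14.1 at `β = 0`** ("Since `χ(−1)τ(χ)² = D`, the proof of Proposition 14.1 is
now reduced to showing (14.5) and (14.6)", p. 78). Bookkeeping: `Θ₂ = Σ_{p∼P}Σ*_ψ Ĩ₂(ψ) + o(𝔓)`
((14.3), regrouped over the window); each `Σ*_ψ Ĩ₂(ψ)` is `τ(χ)χ(p)/D Σ_{D=D₁D₂}𝒮(D₁,D₂;p) +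
O(PT^{−c})` (u010) and `Σ_{p∼P} P T^{−c} ≤ T^{−c}𝔓` since `P < p`; the `D₁ = 1` term gives the main
term by (14.5) and `τ(χ)·χ(−1)τ(χ)/(Dφ(D)) = 1/φ(D)`; the `D₁ > 1` terms are `≪ P²D^{1/2−c}` each by
(14.6), their number is `d(D) ≪ D^{c/2}` (divisor bound), and `|τ(χ)|/D · P²D^{1/2−c'} = P²D^{−c'} =
o(𝔓)` because `𝔓 ≥ P²/(2𝓛⁷⁷)` for large `D` ((2.9)). [cite: Zhang2022LandauSiegel, §14 Prop. 14.1 (proof) pp.76–78, tex L3849–L3917] -/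
theorem dedProp141_holds : DedProp141 := by
  intro h143 h010 h145 h146 B ε hε
  obtain ⟨c₁, hc₁, C₁, h1⟩ := h010 B
  obtain ⟨c₂, hc₂, C₂, h2⟩ := h145 B
  obtain ⟨c₃, hc₃, C₃, h3⟩ := h146 B
  have hε3 : 0 < ε / 3 := by positivity
  obtain ⟨D₀, hall⟩ := (((h143 B (ε / 3) hε3).and h1).and h2).and h3
  -- the divisor bound `d(D) ≤ Cτ D^{c₃/2}`
  obtain ⟨Cτ, hCτ1, hCτ⟩ :=
    Literature.NumberTheory.Sieve.exists_card_divisors_le_mul_rpow (half_pos hc₃)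
  set c : ℝ := min c₂ (c₃ / 2) with hc_def
  have hc : 0 < c := lt_min hc₂ (half_pos hc₃)
  set K : ℝ := |C₂| + |C₃| * Cτ with hK_def
  have hCτ0 : 0 ≤ Cτ := by linarith
  have hK : 0 ≤ K := by positivity
  -- eventual smallness of the error scales
  obtain ⟨D₁, hD₁⟩ := eventually_bigP_sq_le_frakP
  have evT : ∀ᶠ D : ℕ in atTop, |C₁| * bigT D ^ (-c₁) < ε / 3 := by
    have h := (tendsto_bigT_rpow_neg hc₁).const_mul |C₁|
    rw [mul_zero] at h
    exact h.eventually_lt_const hε3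
  have evD : ∀ᶠ D : ℕ in atTop, K * (2 * Real.log D ^ 77) * (D : ℝ) ^ (-c) < ε / 3 := by
    have h := ((tendsto_log_pow_mul_rpow_neg 77 hc).const_mul (2 : ℝ)).const_mul K
    simp only [mul_zero] at h
    refine (h.eventually_lt_const hε3).mono fun D hD => ?_
    calc K * (2 * Real.log D ^ 77) * (D : ℝ) ^ (-c)
        = K * (2 * (Real.log D ^ 77 * (D : ℝ) ^ (-c))) := by ring
      _ < ε / 3 := hD
  obtain ⟨D₂, hD₂⟩ := Filter.eventually_atTop.mp (evT.and evD)
  refine ⟨max (max D₀ D₁) D₂, fun D _ χ hD hq hp hA κs as hκ ha => ?_⟩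
  have hD0 : D₀ ≤ D := le_trans (le_trans (le_max_left _ _) (le_max_left _ _)) hD
  have hD1 : D₁ ≤ D := le_trans (le_trans (le_max_right _ _) (le_max_left _ _)) hD
  have hD2 : D₂ ≤ D := le_trans (le_max_right _ _) hD
  obtain ⟨⟨⟨e143, e010⟩, e145⟩, e146⟩ := hall D χ hD0 hq hp
  obtain ⟨hT, hDc⟩ := hD₂ D hD2
  have hPf := hD₁ D hD1
  have hDpos : (0 : ℝ) < D := by exact_mod_cast Nat.pos_of_ne_zero (NeZero.ne D)
  have hD1' : (1 : ℝ) ≤ D := by exact_mod_cast Nat.one_le_iff_ne_zero.mpr (NeZero.ne D)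
  have hfP : 0 ≤ frakP D := frakP_nonneg D
  -- abbreviations
  set τ : ℂ := GammaFactor.tau χ with hτdef
  set S : ℕ → ℂ := fun p => i2Star χ p κs as with hSdef
  set A : ℕ × ℕ → ℕ → ℂ := fun e p => calS D e.1 e.2 p κs as with hAdef
  set M : ℂ := ∑ p ∈ primeWindow D, mainSum14 χ p κs as with hMdef
  set Sx : ℕ × ℕ → ℂ := fun e => ∑ p ∈ primeWindow D, χ (p : ZMod D) * A e p with hSxdef
  set ER : Finset (ℕ × ℕ) := (Nat.divisorsAntidiagonal D).erase (1, D) with hERdef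
  -- (14.3): the claims
  have E143 : ‖Theta2 χ 0 κs as - ∑ p ∈ primeWindow D, S p‖ ≤ ε / 3 * frakP D := by
    have h := e143 hA κs as hκ ha
    rwa [sum_finsetOf_univ_eq_sum_primeWindow] at h
  have E010 : ∀ p ∈ primeWindow D,
      ‖S p - τ * χ (p : ZMod D) / D * ∑ e ∈ Nat.divisorsAntidiagonal D, A e p‖ ≤
        C₁ * bigP D * bigT D ^ (-c₁) :=
    fun p hp' => e010 hA p hp' κs as hκ ha
  have E145 : ‖Sx (1, D) - χ (-1) * τ / Nat.totient D * M‖ ≤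
      C₂ * bigP D ^ 2 * (D : ℝ) ^ (1 / 2 - c₂) := e145 hA κs as hκ ha
  have E146 : ∀ e ∈ ER, ‖Sx e‖ ≤ C₃ * bigP D ^ 2 * (D : ℝ) ^ (1 / 2 - c₃) := by
    intro e he
    obtain ⟨hne, he'⟩ := Finset.mem_erase.mp he
    obtain ⟨hmul, hD0'⟩ := Nat.mem_divisorsAntidiagonal.mp he'
    have h1 : 1 < e.1 := by
      rcases Nat.lt_or_ge 1 e.1 with h | h
      · exact h
      · exfalso
        have he1 : e.1 ≠ 0 := by
          intro h0; rw [h0, zero_mul] at hmul; exact hD0' hmul.symm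
        have : e.1 = 1 := by omega
        apply hne
        rw [this, one_mul] at hmul
        exact Prod.ext this hmul
    exact e146 hA κs as hκ ha e.1 e.2 hmul h1
  -- the algebra: regrouping the main term
  have h1D : ((1, D) : ℕ × ℕ) ∈ Nat.divisorsAntidiagonal D :=
    Nat.mem_divisorsAntidiagonal.mpr ⟨one_mul D, NeZero.ne D⟩
  have hregroup : ∑ p ∈ primeWindow D, τ * χ (p : ZMod D) / D *
      ∑ e ∈ Nat.divisorsAntidiagonal D, A e p = τ / D * Sx (1, D) + τ / D * ∑ e ∈ ER, Sx e := by
    have step1 : ∀ p ∈ primeWindow D, τ * χ (p : ZMod D) / D * ∑ e ∈ Nat.divisorsAntidiagonal D, A e p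
        = ∑ e ∈ Nat.divisorsAntidiagonal D, τ / D * (χ (p : ZMod D) * A e p) := by
      intro p _
      rw [Finset.mul_sum]
      exact Finset.sum_congr rfl fun e _ => by ring
    rw [Finset.sum_congr rfl step1, Finset.sum_comm]
    have step2 : ∀ e ∈ Nat.divisorsAntidiagonal D,
        ∑ p ∈ primeWindow D, τ / D * (χ (p : ZMod D) * A e p) = τ / D * Sx e := by
      intro e _
      rw [hSxdef, Finset.mul_sum]
    rw [Finset.sum_congr rfl step2, ← Finset.add_sum_erase _ _ h1D, ← Finset.mul_sum]
  have hmain : τ / D * (χ (-1) * τ / Nat.totient D * M) = main141 χ 0 κs as := by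
    have hsq := chi_neg_one_mul_tau_sq χ hq hp
    have hDc : (D : ℂ) ≠ 0 := Nat.cast_ne_zero.mpr (NeZero.ne D)
    have hM' : main141 χ 0 κs as = (Nat.totient D : ℂ)⁻¹ * M := by
      rw [main141_eq, hMdef]
      congr 1
      exact Finset.sum_congr rfl fun p _ => by rw [Complex.cpow_zero, one_mul]
    rw [hM']
    calc τ / D * (χ (-1) * τ / Nat.totient D * M)
        = (χ (-1) * τ ^ 2) / D * ((Nat.totient D : ℂ)⁻¹ * M) := by ring
      _ = (Nat.totient D : ℂ)⁻¹ * M := by rw [hsq, div_self hDc, one_mul]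
  -- the decomposition of `Θ₂ − main term`
  have hdecomp : Theta2 χ 0 κs as - main141 χ 0 κs as =
      (Theta2 χ 0 κs as - ∑ p ∈ primeWindow D, S p) +
      (∑ p ∈ primeWindow D, (S p - τ * χ (p : ZMod D) / D * ∑ e ∈ Nat.divisorsAntidiagonal D, A e p)) +
      τ / D * (Sx (1, D) - χ (-1) * τ / Nat.totient D * M) +
      τ / D * ∑ e ∈ ER, Sx e := by
    rw [Finset.sum_sub_distrib, hregroup, ← hmain]
    ring
  -- sizes
  have hτn : ‖τ / (D : ℂ)‖ = Real.sqrt D / D := by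
    rw [norm_div, hτdef, norm_tau_eq_sqrt χ hp, Complex.norm_natCast]
  have hsqrt : ∀ c' : ℝ, Real.sqrt D / D * (bigP D ^ 2 * (D : ℝ) ^ (1 / 2 - c')) =
      bigP D ^ 2 * (D : ℝ) ^ (-c') := by
    intro c'
    have h12 : (D : ℝ) ^ (1 / 2 - c') = (D : ℝ) ^ (1 / 2 : ℝ) * (D : ℝ) ^ (-c') := by
      rw [sub_eq_add_neg, Real.rpow_add hDpos]
    have hh : (D : ℝ) ^ (1 / 2 : ℝ) * (D : ℝ) ^ (1 / 2 : ℝ) = D := by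
      rw [← Real.rpow_add hDpos]; norm_num
    rw [Real.sqrt_eq_rpow, h12]
    calc (D : ℝ) ^ (1 / 2 : ℝ) / D * (bigP D ^ 2 * ((D : ℝ) ^ (1 / 2 : ℝ) * (D : ℝ) ^ (-c')))
        = ((D : ℝ) ^ (1 / 2 : ℝ) * (D : ℝ) ^ (1 / 2 : ℝ)) / D * (bigP D ^ 2 * (D : ℝ) ^ (-c')) := by
          ring
      _ = bigP D ^ 2 * (D : ℝ) ^ (-c') := by rw [hh, div_self hDpos.ne', one_mul]
  have hrpow_le : ∀ c' : ℝ, c ≤ c' → (D : ℝ) ^ (-c') ≤ (D : ℝ) ^ (-c) := fun c' hc' =>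
    Real.rpow_le_rpow_of_exponent_le hD1' (by linarith)
  -- term 2: `Σ_p C₁PT^{-c₁} ≤ |C₁|T^{-c₁}𝔓`
  have hT0 : 0 ≤ bigT D ^ (-c₁) := Real.rpow_nonneg (Real.exp_pos _).le _
  have term2 : ‖∑ p ∈ primeWindow D,
      (S p - τ * χ (p : ZMod D) / D * ∑ e ∈ Nat.divisorsAntidiagonal D, A e p)‖ ≤
        ε / 3 * frakP D := by
    calc ‖∑ p ∈ primeWindow D,
          (S p - τ * χ (p : ZMod D) / D * ∑ e ∈ Nat.divisorsAntidiagonal D, A e p)‖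
        ≤ ∑ p ∈ primeWindow D,
            ‖S p - τ * χ (p : ZMod D) / D * ∑ e ∈ Nat.divisorsAntidiagonal D, A e p‖ :=
          norm_sum_le _ _
      _ ≤ ∑ p ∈ primeWindow D, |C₁| * bigT D ^ (-c₁) * (p : ℝ) := by
          refine Finset.sum_le_sum fun p hp' => (E010 p hp').trans ?_
          have hPp : bigP D ≤ p := (bigP_lt_of_mem_primeWindow hp').le
          have hP0 : 0 ≤ bigP D := (Real.exp_pos _).le
          calc C₁ * bigP D * bigT D ^ (-c₁) ≤ |C₁| * bigP D * bigT D ^ (-c₁) := by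
                gcongr; exact le_abs_self C₁
            _ ≤ |C₁| * p * bigT D ^ (-c₁) := by gcongr
            _ = |C₁| * bigT D ^ (-c₁) * (p : ℝ) := by ring
      _ = |C₁| * bigT D ^ (-c₁) * frakP D := by
          rw [← Finset.mul_sum, frakP_eq_sum_primeWindow]
      _ ≤ ε / 3 * frakP D := by gcongr
  -- terms 3 and 4
  have term3 : ‖τ / D * (Sx (1, D) - χ (-1) * τ / Nat.totient D * M)‖ ≤
      |C₂| * (bigP D ^ 2 * (D : ℝ) ^ (-c)) := by
    rw [norm_mul, hτn]
    calc Real.sqrt D / D * ‖Sx (1, D) - χ (-1) * τ / Nat.totient D * M‖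
        ≤ Real.sqrt D / D * (|C₂| * (bigP D ^ 2 * (D : ℝ) ^ (1 / 2 - c₂))) := by
          gcongr
          calc ‖Sx (1, D) - χ (-1) * τ / Nat.totient D * M‖
              ≤ C₂ * bigP D ^ 2 * (D : ℝ) ^ (1 / 2 - c₂) := E145
            _ ≤ |C₂| * bigP D ^ 2 * (D : ℝ) ^ (1 / 2 - c₂) := by
                gcongr; exact le_abs_self C₂
            _ = |C₂| * (bigP D ^ 2 * (D : ℝ) ^ (1 / 2 - c₂)) := by ring
      _ = |C₂| * (bigP D ^ 2 * (D : ℝ) ^ (-c₂)) := by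
          rw [mul_left_comm, hsqrt c₂]
      _ ≤ |C₂| * (bigP D ^ 2 * (D : ℝ) ^ (-c)) :=
          mul_le_mul_of_nonneg_left (mul_le_mul_of_nonneg_left (hrpow_le c₂ (min_le_left _ _))
            (sq_nonneg _)) (abs_nonneg _)
  have hcardER : (ER.card : ℝ) ≤ Cτ * (D : ℝ) ^ (c₃ / 2) := by
    calc (ER.card : ℝ) ≤ ((Nat.divisorsAntidiagonal D).card : ℝ) := by
          exact_mod_cast Finset.card_erase_le
      _ = (D.divisors.card : ℝ) := by rw [card_divisorsAntidiagonal_eq]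
      _ ≤ Cτ * (D : ℝ) ^ (c₃ / 2) := hCτ D (NeZero.ne D)
  have term4 : ‖τ / D * ∑ e ∈ ER, Sx e‖ ≤ |C₃| * Cτ * (bigP D ^ 2 * (D : ℝ) ^ (-c)) := by
    rw [norm_mul, hτn]
    have hP2 : 0 ≤ bigP D ^ 2 := sq_nonneg _
    calc Real.sqrt D / D * ‖∑ e ∈ ER, Sx e‖
        ≤ Real.sqrt D / D * ∑ e ∈ ER, ‖Sx e‖ := by gcongr; exact norm_sum_le _ _
      _ ≤ Real.sqrt D / D * ∑ e ∈ ER, |C₃| * bigP D ^ 2 * (D : ℝ) ^ (1 / 2 - c₃) := by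
          gcongr with e he
          exact (E146 e he).trans (by gcongr; exact le_abs_self C₃)
      _ = ER.card * (|C₃| * (Real.sqrt D / D * (bigP D ^ 2 * (D : ℝ) ^ (1 / 2 - c₃)))) := by
          rw [Finset.sum_const, nsmul_eq_mul]; ring
      _ = ER.card * (|C₃| * (bigP D ^ 2 * (D : ℝ) ^ (-c₃))) := by rw [hsqrt c₃]
      _ ≤ (Cτ * (D : ℝ) ^ (c₃ / 2)) * (|C₃| * (bigP D ^ 2 * (D : ℝ) ^ (-c₃))) := by
          gcongr
      _ = |C₃| * Cτ * (bigP D ^ 2 * ((D : ℝ) ^ (c₃ / 2) * (D : ℝ) ^ (-c₃))) := by ring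
      _ = |C₃| * Cτ * (bigP D ^ 2 * (D : ℝ) ^ (-(c₃ / 2))) := by
          have hx : (D : ℝ) ^ (c₃ / 2) * (D : ℝ) ^ (-c₃) = (D : ℝ) ^ (-(c₃ / 2)) := by
            rw [← Real.rpow_add hDpos]; congr 1; ring
          rw [hx]
      _ ≤ |C₃| * Cτ * (bigP D ^ 2 * (D : ℝ) ^ (-c)) :=
          mul_le_mul_of_nonneg_left (mul_le_mul_of_nonneg_left
            (hrpow_le (c₃ / 2) (min_le_right _ _)) (sq_nonneg _)) (by positivity)
  have term34 : |C₂| * (bigP D ^ 2 * (D : ℝ) ^ (-c)) + |C₃| * Cτ * (bigP D ^ 2 * (D : ℝ) ^ (-c)) ≤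
      ε / 3 * frakP D := by
    have hDc0 : 0 ≤ (D : ℝ) ^ (-c) := Real.rpow_nonneg hDpos.le _
    calc |C₂| * (bigP D ^ 2 * (D : ℝ) ^ (-c)) + |C₃| * Cτ * (bigP D ^ 2 * (D : ℝ) ^ (-c))
        = K * (bigP D ^ 2 * (D : ℝ) ^ (-c)) := by rw [hK_def]; ring
      _ ≤ K * ((2 * ell D ^ 77 * frakP D) * (D : ℝ) ^ (-c)) := by gcongr
      _ = (K * (2 * Real.log D ^ 77) * (D : ℝ) ^ (-c)) * frakP D := by rw [ell]; ring
      _ ≤ ε / 3 * frakP D := by gcongr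
  -- conclusion
  rw [hdecomp]
  have n4 : ∀ a b c d : ℂ, ‖a + b + c + d‖ ≤ ‖a‖ + ‖b‖ + ‖c‖ + ‖d‖ := fun a b c d => by
    calc ‖a + b + c + d‖ ≤ ‖a + b + c‖ + ‖d‖ := norm_add_le _ _
      _ ≤ ‖a + b‖ + ‖c‖ + ‖d‖ := by gcongr; exact norm_add_le _ _
      _ ≤ ‖a‖ + ‖b‖ + ‖c‖ + ‖d‖ := by gcongr; exact norm_add_le _ _
  refine (n4 _ _ _ _).trans ?_
  linarith [E143, term2, term3, term4, term34]

/-- `DedProp141` — `_holds` alias of `dedProp141_holds` above under the fact's exact name (appended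
2026-08-28, D-0026 bookkeeping: the proof term is the existing theorem of this file; no statement,
definition or attribute is edited; no new named fact; the ledger's debt table listed the fact
unproved). [cite: Zhang2022LandauSiegel, §14 Prop. 14.1 (proof) pp.76–78, tex L3849–L3917] -/
theorem _root_.Literature.NumberTheory.LFunctions.Zhang2022.Typed.Sec14.DedProp141_holds :
    DedProp141 :=
  _root_.Literature.NumberTheory.LFunctions.Zhang2022.Typed.Sec14.dedProp141_holds


end Literature.NumberTheory.LFunctions.Zhang2022.Typed.Sec14
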